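import Summits.BirchSwinnertonDyer.Rank1Residual.Additive.LocalReductionIndex
import Summits.BirchSwinnertonDyer.Rank1Residual.X11b.LocalTorsionAwayFromP
import Summits.BirchSwinnertonDyer.Rank1Residual.X11b.Three.GoodReductionSubgroupCuspPadic
import HarnessLib

/-!
# Torsion of `E(ℚ_p)` for `p ≥ 3`: `#E(ℚ_p)_tors ∣ c_p · #Ẽ_ns(𝔽_p)`; at an ADDITIVE prime with `p ∤ c_p`
# the `p`-primary torsion is killed by `p` (`E(ℚ_p)[p^∞] = E(ℚ_p)[p]`, `#E(ℚ_p)[p] = p^t`, `t ≤ 1`)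
# (cell `b2b-bsdres`, team n1011, row T-R1-24 — r1's requested lemma for the R1-23 depth binder;
# seat n1011-p05 gen 3)

HONEST FRAMING (cell `b2b-bsdres`, run/shared/lean/b2b/bsd-rank1-residual/, verbatim in every
file): the goal of the cell is to DELETE the COMBINATION-SHAPED residual classes of the
Birch–Swinnerton-Dyer formula for ALL analytic-rank `≤ 1` elliptic curves over `ℚ` — "full BSD
formula for every rank `≤ 1` curve in class `C`" assembled STRICTLY from published theorems — so
that the rank-`≤ 1` remainder becomes exactly the CONSTRUCTION-SHAPED classes, which are TYPED
(missing-input `Prop`s), NOT attempted. This is not "finishing BSD". Team n1011, ROUTE-1 (a′):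
research route; TOOL theorems on local points only; no definition, no named fact; nothing booked.

## What and why

ROUTE-1 §20 (planner r1) carries the depth binder `k ≥ j + e`, `p^e = #E(ℚ₃)[3]` (spelled
`Nat.log 3 #{P : E(ℚ₃) // 3 • P = 0}` in `route1/R23_endshape.lean`), while `PadicLogImage` / `LocalReductionIndex` output
`t = v_p #E(ℚ_p)_tors` (`p^t = #E(ℚ_p)[p^∞]`).  r1 (INBOX 2026-08-21T09:31Z) asked for the lemma making the two agree on
the `3 ∤ c₃` rows: **`E(ℚ₃)[3^∞] = E(ℚ₃)[3]`**.  Silverman *AEC* VII.3.1: for `p ≥ 3` the kernel of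
reduction `E₁(ℚ_p) ≅ Ê(pℤ_p)` is TORSION-FREE (no `p`-torsion: IV.6.1 with `v(p) = 1 < p − 1`, tree
`stubC_eq_zero_of_isInReductionKernel`; no prime-to-`p` torsion: IV.3.2(b), x11b
`LocalTorsion.eq_zero_of_isInReductionKernel_of_prime_nsmul`), so the torsion subgroup `T` of
`E(ℚ_p)` embeds in `E(ℚ_p)/E₁(ℚ_p)`, of order `c_p · #Ẽ_ns(𝔽_p)` (tree `index_formalFiltration`):

* `eq_zero_of_isInReductionKernel_of_isOfFinAddOrder` — `E₁(ℚ_p)_tors = 0` (`p ≥ 3`, integral `X`);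
* `card_torsion_dvd_index_formalFiltration_zero` — `#T ∣ [E(ℚ_p) : E₁(ℚ_p)]`; minimal `X`:
  **`card_torsion_dvd_of_isMinimal` — `#E(ℚ_p)_tors ∣ c_p · #Ẽ_ns(𝔽_p)`**; additive `X`:
  `card_torsion_dvd_of_hasAdditiveReduction` — `#E(ℚ_p)_tors ∣ c_p · p`, and with `p ∤ c_p`:
  `padicValNat_card_torsion_le_one` — **`t ≤ 1`**;
* **`nsmul_eq_zero_of_pow_nsmul_eq_zero`** — additive, `p ≥ 3`, `p ∤ c_p`: `p^k • P = 0 ⟹ p • P = 0`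
  (**`E(ℚ_p)[p^∞] = E(ℚ_p)[p]`**: `(c_p p) • P ∈ E₁(ℚ_p)_tors = 0` and `gcd(c_p, p^{k−1}) = 1`);
* **`natCard_nsmul_eq_zero_eq_pow`** — additive, `p ≥ 3`, `p ∤ c_p`:
  **`#{P : E(ℚ_p) // p • P = 0} = p^t`**, `t = v_p #E(ℚ_p)_tors` (`×p` on `T`: kernel = `E(ℚ_p)[p]` a
  `p`-group, image without `p`-torsion); with `LocalReductionIndex`'s `natCard_primaryComponent_point_eq_pow`
  (`#E(ℚ_p)[p^∞] = p^t`, every `p`) this says `E(ℚ_p)[p^∞] = E(ℚ_p)[p]` as a count too;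
* §3 the `ℚ`-curve spellings on `Addv W p`, `3 ≤ p`, `p ∤ c_p` (r1's binder, both currencies):
  `nsmul_eq_zero_of_pow_nsmul_eq_zero_of_addv`, `natCard_nsmul_eq_zero_eq_pow_of_addv`,
  `padicValNat_card_torsion_le_one_of_addv`,
  `log_natCard_nsmul_eq_zero_eq_of_addv` (r1's
  `Nat.log p #E(ℚ_p)[p]` with the `ℤ`-cast divisibility, verbatim), `card_torsion_baseChange_dvd`.

References: [SilvermanAEC2009] IV.3.2(b), IV.6.1, VII.2.1–2.2, VII.3.1, VII.6.1.
-/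

noncomputable section

open scoped Classical

namespace Summit.BirchSwinnertonDyer.Rank1Residual.Additive.LocalLog

open WeierstrassCurve Summit.BirchSwinnertonDyer.Rank1Residual.X11b
  Summit.BirchSwinnertonDyer.BirchSwinnertonDyer.Theorems
  Literature.NumberTheory.EllipticCurves Literature.NumberTheory.EllipticCurves.Rank1Residual

/-! ## §1 `E₁(ℚ_p)` is torsion-free for `p ≥ 3`; `#E(ℚ_p)_tors ∣ c_p · #Ẽ_ns(𝔽_p)` -/

section Integral

variable {p : ℕ} [hp : Fact p.Prime] (X : WeierstrassCurve ℚ_[p]) [hX : X.IsIntegral ℤ_[p]] [X.IsElliptic]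

/-- **`E₁(ℚ_p)` is torsion-free for `p ≥ 3`** (integral equation): a torsion point in the kernel of
reduction is `O`.  If `Q ≠ O` has order `n > 1` and `ℓ` is a prime factor of `n`, then
`Q' = (n/ℓ) • Q ∈ E₁(ℚ_p)` has `ℓ • Q' = O`, `Q' ≠ O`; `ℓ = p` contradicts `E₁(ℚ_p)[p] = 0`
(tree `stubC_eq_zero_of_isInReductionKernel`, AEC VII.3.1/IV.6.1, `p ≥ 3`), `ℓ ≠ p` contradicts
`E₁(ℚ_p)[ℓ] = 0` (x11b `eq_zero_of_isInReductionKernel_of_prime_nsmul`, AEC IV.3.2(b)).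
[cite: SilvermanAEC2009, VII.3 Prop. 3.1 and IV.3.2(b), IV.6.1] -/
theorem eq_zero_of_isInReductionKernel_of_isOfFinAddOrder (hp3 : 3 ≤ p) {Q : X.toAffine.Point}
    (hQ : X.IsInReductionKernel Q) (hfin : IsOfFinAddOrder Q) : Q = 0 := by
  by_contra hQ0
  set n := addOrderOf Q with hn
  have hn0 : 0 < n := hfin.addOrderOf_pos
  have hn1 : n ≠ 1 := fun h => hQ0 (AddMonoid.addOrderOf_eq_one_iff.mp h)
  set ℓ := n.minFac with hℓ
  have hℓp : ℓ.Prime := Nat.minFac_prime hn1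
  have hℓn : ℓ ∣ n := Nat.minFac_dvd n
  have hdiv0 : 0 < n / ℓ := Nat.div_pos (Nat.le_of_dvd hn0 hℓn) hℓp.pos
  set Q' := (n / ℓ) • Q with hQ'
  have hQ'mem : X.IsInReductionKernel Q' :=
    X.mem_formalFiltration_zero_iff.mp
      ((X.formalFiltration 0).nsmul_mem (X.mem_formalFiltration_zero_iff.mpr hQ) _)
  have hQ'ne : Q' ≠ 0 := nsmul_ne_zero_of_lt_addOrderOf hdiv0.ne' (Nat.div_lt_self hn0 hℓp.one_lt)
  have hkill : ℓ • Q' = 0 := by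
    rw [hQ', smul_smul, Nat.mul_div_cancel' hℓn]
    exact addOrderOf_nsmul_eq_zero Q
  by_cases hℓeq : ℓ = p
  · obtain ⟨W₀, hW₀⟩ : ∃ W₀ : WeierstrassCurve ℤ_[p], X = W₀.baseChange ℚ_[p] := IsIntegral.integral
    rw [hℓeq] at hkill
    have hz : (p : ℤ) • Q' = 0 := by rw [natCast_zsmul]; exact hkill
    exact hQ'ne (stubC_eq_zero_of_isInReductionKernel hp3 W₀ X hW₀.symm Q' hQ'mem hz)
  · exact hQ'ne (LocalTorsion.eq_zero_of_isInReductionKernel_of_prime_nsmul X hℓp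
      (fun h => hℓeq h.symm) hQ'mem hkill)

/-- `E₁(ℚ_p) ∩ E(ℚ_p)_tors = 0` for `p ≥ 3`. [cite: SilvermanAEC2009, VII.3 Prop. 3.1] -/
theorem addSubgroupOf_torsion_formalFiltration_zero_eq_bot (hp3 : 3 ≤ p) :
    (X.formalFiltration 0).addSubgroupOf (AddCommGroup.torsion X.toAffine.Point) = ⊥ := by
  rw [eq_bot_iff]
  rintro ⟨t, ht⟩ htE
  rw [AddSubgroup.mem_bot]
  exact Subtype.ext (eq_zero_of_isInReductionKernel_of_isOfFinAddOrder X hp3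
    (X.mem_formalFiltration_zero_iff.mp htE) ht)

/-- **`#E(ℚ_p)_tors ∣ [E(ℚ_p) : E₁(ℚ_p)]`** for `p ≥ 3` (the torsion embeds in `E(ℚ_p)/E₁(ℚ_p)`).
[cite: SilvermanAEC2009, VII.3 Prop. 3.1] -/
theorem card_torsion_dvd_index_formalFiltration_zero (hp3 : 3 ≤ p) :
    Nat.card (AddCommGroup.torsion X.toAffine.Point) ∣ (X.formalFiltration 0).index := by
  set E := X.formalFiltration 0 with hE
  set T := AddCommGroup.torsion X.toAffine.Point with hT
  have h5 : Nat.card (E.addSubgroupOf T) * E.relIndex T = Nat.card T := AddSubgroup.card_mul_index _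
  rw [hE, hT, addSubgroupOf_torsion_formalFiltration_zero_eq_bot X hp3, AddSubgroup.card_bot, one_mul,
    ← hE, ← hT] at h5
  have h4 : E.relIndex (E ⊔ T) = E.relIndex T := AddSubgroup.relIndex_sup_left _ _
  have h3 : E.relIndex (E ⊔ T) * (E ⊔ T).index = E.index := AddSubgroup.relIndex_mul_index le_sup_left
  exact ⟨(E ⊔ T).index, by rw [← h3, h4, h5]⟩

end Integral

section Minimal

variable {p : ℕ} [hp : Fact p.Prime] (X : WeierstrassCurve ℚ_[p]) [X.IsMinimal ℤ_[p]] [X.IsElliptic]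

/-- `[E(ℚ_p) : E₁(ℚ_p)] = c_p · #Ẽ_ns(𝔽_p)` for a minimal equation (`E₁ = E⁽⁰⁾ = E⁽¹⁾`, tree
`index_formalFiltration`). [cite: SilvermanAEC2009, VII.2 Prop. 2.1 and VII.6.1] -/
theorem index_formalFiltration_zero_eq :
    (X.formalFiltration 0).index = X.localTamagawaNumber ℤ_[p] * Nat.card (X.reduction ℤ_[p]).toAffine.Point := by
  rw [← X.formalFiltration_one_eq_zero, X.index_formalFiltration le_rfl, pow_zero, mul_one]

/-- **`#E(ℚ_p)_tors ∣ c_p · #Ẽ_ns(𝔽_p)` for `p ≥ 3`** (minimal equation, ANY reduction type).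
[cite: SilvermanAEC2009, VII.3 Prop. 3.1 with VII.2.1 and VII.6.1] -/
theorem card_torsion_dvd_of_isMinimal (hp3 : 3 ≤ p) :
    Nat.card (AddCommGroup.torsion X.toAffine.Point) ∣
      X.localTamagawaNumber ℤ_[p] * Nat.card (X.reduction ℤ_[p]).toAffine.Point := by
  rw [← index_formalFiltration_zero_eq]
  exact card_torsion_dvd_index_formalFiltration_zero X hp3

end Minimal

/-! ## §2 Additive reduction, `p ≥ 3`, `p ∤ c_p`: `E(ℚ_p)[p^∞] = E(ℚ_p)[p]`, `#E(ℚ_p)[p] = p^t`, `t ≤ 1` -/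

section Additive

variable {p : ℕ} [hp : Fact p.Prime] (X : WeierstrassCurve ℚ_[p]) [hadd : X.HasAdditiveReduction ℤ_[p]]
  [X.IsElliptic]

/-- **`#E(ℚ_p)_tors ∣ c_p · p` at an additive `p ≥ 3`** (`#Ẽ_ns(𝔽_p) = p`).
[cite: SilvermanAEC2009, VII.3 Prop. 3.1 with VII.6.1 and Exercise 3.5] -/
theorem card_torsion_dvd_of_hasAdditiveReduction (hp3 : 3 ≤ p) :
    Nat.card (AddCommGroup.torsion X.toAffine.Point) ∣ X.localTamagawaNumber ℤ_[p] * p := by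
  have h := card_torsion_dvd_of_isMinimal X hp3
  rwa [natCard_point_reduction_of_hasAdditiveReduction X] at h

/-- **`t ≤ 1`**: at an additive `p ≥ 3` with `p ∤ c_p`, `v_p #E(ℚ_p)_tors ≤ 1`.
[cite: SilvermanAEC2009, VII.3 Prop. 3.1 with VII.6.1] -/
theorem padicValNat_card_torsion_le_one (hp3 : 3 ≤ p) (hcp : ¬ p ∣ X.localTamagawaNumber ℤ_[p]) :
    padicValNat p (Nat.card (AddCommGroup.torsion X.toAffine.Point)) ≤ 1 := by
  have hc0 : X.localTamagawaNumber ℤ_[p] ≠ 0 := fun h => hcp (h ▸ dvd_zero p)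
  have hne : X.localTamagawaNumber ℤ_[p] * p ≠ 0 := mul_ne_zero hc0 hp.out.ne_zero
  have h1 : p ^ padicValNat p (Nat.card (AddCommGroup.torsion X.toAffine.Point)) ∣
      X.localTamagawaNumber ℤ_[p] * p :=
    pow_padicValNat_dvd.trans (card_torsion_dvd_of_hasAdditiveReduction X hp3)
  rw [padicValNat_dvd_iff_le hne, padicValNat.mul hc0 hp.out.ne_zero,
    padicValNat.eq_zero_of_not_dvd hcp, padicValNat.self hp.out.one_lt] at h1
  omega

/-- **`E(ℚ_p)[p^∞] = E(ℚ_p)[p]` at an additive `p ≥ 3` with `p ∤ c_p`**: `p^k • P = O ⟹ p • P = O`.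
(`(c_p · p) • P ∈ E₁(ℚ_p)` is torsion, hence `O`; so `p • P` is killed by `c_p` and by `p^{k−1}`,
which are coprime.) Kim's `E(ℚ_p)[p^∞]` of Lemma 3.10 therefore has order `p^t` with `t ≤ 1` on these
rows. [cite: SilvermanAEC2009, VII.3 Prop. 3.1 with VII.2.1 and VII.6.1] -/
theorem nsmul_eq_zero_of_pow_nsmul_eq_zero (hp3 : 3 ≤ p) (hcp : ¬ p ∣ X.localTamagawaNumber ℤ_[p])
    {P : X.toAffine.Point} {k : ℕ} (hP : p ^ k • P = 0) : p • P = 0 := by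
  rcases k with _ | k
  · rw [pow_zero, one_nsmul] at hP; rw [hP, nsmul_zero]
  have hfin : IsOfFinAddOrder P :=
    isOfFinAddOrder_iff_nsmul_eq_zero.mpr ⟨p ^ (k + 1), pow_pos hp.out.pos _, hP⟩
  -- `(c_p p) • P ∈ E₁ ∩ tors = 0`
  set c := X.localTamagawaNumber ℤ_[p] with hc
  have hidx : (X.formalFiltration 0).index = c * p := by
    rw [index_formalFiltration_zero_eq, natCard_point_reduction_of_hasAdditiveReduction X]
  have hmem : (c * p) • P ∈ X.formalFiltration 0 := by
    rw [← hidx]; exact (X.formalFiltration 0).nsmul_index_mem P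
  have hzero : (c * p) • P = 0 :=
    eq_zero_of_isInReductionKernel_of_isOfFinAddOrder X hp3 (X.mem_formalFiltration_zero_iff.mp hmem)
      hfin.nsmul
  -- `p • P` is killed by `c` and by `p^k`
  have h1 : c • (p • P) = 0 := by rw [smul_smul]; exact hzero
  have h2 : p ^ k • (p • P) = 0 := by rw [smul_smul, ← pow_succ]; exact hP
  have hcop : Nat.Coprime c (p ^ k) :=
    Nat.Coprime.pow_right k ((Nat.Prime.coprime_iff_not_dvd hp.out).mpr hcp).symm
  have hd1 : addOrderOf (p • P) ∣ c := addOrderOf_dvd_iff_nsmul_eq_zero.mpr h1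
  have hd2 : addOrderOf (p • P) ∣ p ^ k := addOrderOf_dvd_iff_nsmul_eq_zero.mpr h2
  have hd : addOrderOf (p • P) ∣ 1 := hcop ▸ Nat.dvd_gcd hd1 hd2
  exact AddMonoid.addOrderOf_eq_one_iff.mp (Nat.dvd_one.mp hd)

/-- **`#E(ℚ_p)[p] = p^t`, `t = v_p #E(ℚ_p)_tors`, at an additive `p ≥ 3` with `p ∤ c_p`** — r1's
depth-binder currency `#{P // p • P = 0}` and `PadicLogImage`'s `t` agree (and `t ≤ 1`).  Proof:
multiplication by `p` on the finite torsion group `T` has kernel `E(ℚ_p)[p]` (a `p`-group) and an image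
with no element of order `p` (`p • (p • x) = 0 ⟹ p • x = 0`), so `#T = #E(ℚ_p)[p] · #(pT)` with
`p ∤ #(pT)`. [cite: SilvermanAEC2009, VII.3 Prop. 3.1 with VII.6.1] -/
theorem natCard_nsmul_eq_zero_eq_pow (hp3 : 3 ≤ p) (hcp : ¬ p ∣ X.localTamagawaNumber ℤ_[p]) :
    Nat.card {P : X.toAffine.Point // p • P = 0} =
      p ^ padicValNat p (Nat.card (AddCommGroup.torsion X.toAffine.Point)) := by
  set T := AddCommGroup.torsion X.toAffine.Point with hT
  haveI : Finite T := finite_torsion_point X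
  set f : T →+ T := nsmulAddMonoidHom p with hf
  have hfapply : ∀ x : T, f x = p • x := fun x => rfl
  -- (a) `ker f ≃ E(ℚ_p)[p]`
  have hmemT : ∀ P : X.toAffine.Point, p • P = 0 → P ∈ T := fun P hP =>
    isOfFinAddOrder_iff_nsmul_eq_zero.mpr ⟨p, hp.out.pos, hP⟩
  have hker_iff : ∀ x : T, x ∈ f.ker ↔ p • (x : X.toAffine.Point) = 0 := by
    intro x
    rw [AddMonoidHom.mem_ker, hfapply]
    constructor
    · intro h; have h' := congrArg Subtype.val h; simpa using h'
    · intro h; apply Subtype.ext; simpa using h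
  have ekey : f.ker ≃ {P : X.toAffine.Point // p • P = 0} :=
    { toFun := fun x => ⟨((x : T) : X.toAffine.Point), (hker_iff x).mp x.2⟩
      invFun := fun P => ⟨⟨P.1, hmemT P.1 P.2⟩, (hker_iff _).mpr P.2⟩
      left_inv := fun x => by ext; rfl
      right_inv := fun P => by ext; rfl }
  have hker : Nat.card f.ker = Nat.card {P : X.toAffine.Point // p • P = 0} := Nat.card_congr ekey
  -- (b) the image has no element of order `p`
  have hrange : ¬ p ∣ Nat.card f.range := by
    intro hdvd
    obtain ⟨y, hy⟩ := exists_prime_addOrderOf_dvd_card' (G := f.range) p hdvd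
    obtain ⟨x, hx⟩ := y.2
    -- `p • y = 0` in `E(ℚ_p)`
    have hpy : p • (((y : f.range) : T) : X.toAffine.Point) = 0 := by
      have h1 : addOrderOf y • y = 0 := addOrderOf_nsmul_eq_zero y
      rw [hy] at h1
      have h2 := congrArg (fun z : f.range => ((z : T) : X.toAffine.Point)) h1
      simpa using h2
    -- `y = p • x`, so `p² • x = 0`, hence `p • x = 0`, i.e. `y = 0`
    have hxy : p • ((x : T) : X.toAffine.Point) = (((y : f.range) : T) : X.toAffine.Point) := by
      have h1 : f x = (y : T) := hx
      rw [hfapply] at h1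
      have h2 := congrArg Subtype.val h1
      simpa using h2
    have hppx : p ^ 2 • ((x : T) : X.toAffine.Point) = 0 := by
      rw [pow_two, ← smul_smul, hxy, hpy]
    have hpx : p • ((x : T) : X.toAffine.Point) = 0 :=
      nsmul_eq_zero_of_pow_nsmul_eq_zero X hp3 hcp hppx
    have hy0 : y = 0 := by
      apply Subtype.ext
      apply Subtype.ext
      change (((y : f.range) : T) : X.toAffine.Point) = 0
      rw [← hxy, hpx]
    rw [hy0, addOrderOf_zero] at hy
    exact hp.out.one_lt.ne' hy.symm
  -- (c) the kernel is a `p`-group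
  have hkerpow : ∃ s : ℕ, Nat.card f.ker = p ^ s := by
    refine ⟨_, Nat.eq_prime_pow_of_unique_prime_dvd (Nat.card_pos (α := f.ker)).ne' ?_⟩
    intro d hd hdvd
    haveI := Fact.mk hd
    obtain ⟨x, hx⟩ := exists_prime_addOrderOf_dvd_card' (G := f.ker) d hdvd
    have hpx : p • x = 0 := by
      have h1 := (hker_iff (x : T)).mp x.2
      have hinj : Function.Injective (T.subtype.comp f.ker.subtype) :=
        Subtype.val_injective.comp Subtype.val_injective
      apply hinj
      rw [map_nsmul, map_zero]
      exact h1
    have hdp : d ∣ p := hx ▸ addOrderOf_dvd_iff_nsmul_eq_zero.mpr hpx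
    exact (Nat.prime_dvd_prime_iff_eq hd hp.out).mp hdp
  obtain ⟨s, hs⟩ := hkerpow
  -- (d) count
  have hcount : Nat.card T = Nat.card f.range * Nat.card f.ker := by
    rw [AddSubgroup.card_eq_card_quotient_mul_card_addSubgroup f.ker,
      Nat.card_congr (QuotientAddGroup.quotientKerEquivRange f).toEquiv]
  have hrange0 : Nat.card f.range ≠ 0 := (Nat.card_pos (α := f.range)).ne'
  have ht : padicValNat p (Nat.card T) = s := by
    rw [hcount, hs, padicValNat.mul hrange0 (pow_ne_zero s hp.out.ne_zero),
      padicValNat.eq_zero_of_not_dvd hrange, padicValNat.prime_pow, zero_add]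
  rw [← hker, hs, ht]

end Additive

/-! ## §3 The `ℚ`-curve spellings (r1's binder): `Addv W p`, `3 ≤ p`, `p ∤ c_p` -/

section Rat

variable (W : WeierstrassCurve ℚ) [W.IsElliptic] [W.IsGloballyMinimal] (p : ℕ) [hp : Fact p.Prime]

/-- **`E(ℚ_p)[p^∞] = E(ℚ_p)[p]` for `E/ℚ` at an additive `p ≥ 3` with `p ∤ c_p`** (`p = 3`: the
`3 ∤ c₃` rows of N10/N11): `p^k • P = O ⟹ p • P = O`. [cite: SilvermanAEC2009, VII.3 Prop. 3.1 with VII.2.1 and VII.6.1] -/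
theorem nsmul_eq_zero_of_pow_nsmul_eq_zero_of_addv (hp3 : 3 ≤ p) (hadd : Addv W p)
    (hcp : ¬ p ∣ (W.baseChange ℚ_[p]).localTamagawaNumber ℤ_[p])
    {P : (W.baseChange ℚ_[p]).toAffine.Point} {k : ℕ} (hP : p ^ k • P = 0) : p • P = 0 := by
  haveI := Three.JetchevKummer.hasAdditiveReduction_baseChange_padic_of_not_good_of_not_mult W p
    hadd.1 hadd.2
  exact nsmul_eq_zero_of_pow_nsmul_eq_zero (W.baseChange ℚ_[p]) hp3 hcp hP

/-- **`#E(ℚ_p)[p] = p^t` with `t = v_p #E(ℚ_p)_tors ≤ 1`** for `E/ℚ` at an additive `p ≥ 3` with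
`p ∤ c_p` — r1's R1-23 depth binder `Nat.log p #{P // p • P = 0}` equals `PadicLogImage`'s `t`.
[cite: SilvermanAEC2009, VII.3 Prop. 3.1 with VII.6.1] -/
theorem natCard_nsmul_eq_zero_eq_pow_of_addv (hp3 : 3 ≤ p) (hadd : Addv W p)
    (hcp : ¬ p ∣ (W.baseChange ℚ_[p]).localTamagawaNumber ℤ_[p]) :
    Nat.card {P : (W.baseChange ℚ_[p]).toAffine.Point // p • P = 0} =
      p ^ padicValNat p (Nat.card (AddCommGroup.torsion (W.baseChange ℚ_[p]).toAffine.Point)) := by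
  haveI := Three.JetchevKummer.hasAdditiveReduction_baseChange_padic_of_not_good_of_not_mult W p
    hadd.1 hadd.2
  exact natCard_nsmul_eq_zero_eq_pow (W.baseChange ℚ_[p]) hp3 hcp

/-- **`t ≤ 1`** for `E/ℚ` at an additive `p ≥ 3` with `p ∤ c_p`: `v_p #E(ℚ_p)_tors ≤ 1`.
[cite: SilvermanAEC2009, VII.3 Prop. 3.1 with VII.6.1] -/
theorem padicValNat_card_torsion_le_one_of_addv (hp3 : 3 ≤ p) (hadd : Addv W p)
    (hcp : ¬ p ∣ (W.baseChange ℚ_[p]).localTamagawaNumber ℤ_[p]) :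
    padicValNat p (Nat.card (AddCommGroup.torsion (W.baseChange ℚ_[p]).toAffine.Point)) ≤ 1 := by
  haveI := Three.JetchevKummer.hasAdditiveReduction_baseChange_padic_of_not_good_of_not_mult W p
    hadd.1 hadd.2
  exact padicValNat_card_torsion_le_one (W.baseChange ℚ_[p]) hp3 hcp

/-- **r1's R1-23 depth binder, literally** (`route1/R23_endshape.lean`: `Nat.log p #{P // p • P = 0}`
with `¬ (p : ℤ) ∣ c_p`): `Nat.log p #E(ℚ_p)[p] = v_p #E(ℚ_p)_tors` on `Addv W p`, `3 ≤ p`, `p ∤ c_p`.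
[cite: SilvermanAEC2009, VII.3 Prop. 3.1 with VII.6.1] -/
theorem log_natCard_nsmul_eq_zero_eq_of_addv (hp3 : 3 ≤ p) (hadd : Addv W p)
    (hcp : ¬ (p : ℤ) ∣ ((W.baseChange ℚ_[p]).localTamagawaNumber ℤ_[p] : ℤ)) :
    Nat.log p (Nat.card {P : (W.baseChange ℚ_[p]).toAffine.Point // p • P = 0}) =
      padicValNat p (Nat.card (AddCommGroup.torsion (W.baseChange ℚ_[p]).toAffine.Point)) := by
  rw [Int.natCast_dvd_natCast] at hcp
  rw [natCard_nsmul_eq_zero_eq_pow_of_addv W p hp3 hadd hcp, Nat.log_pow hp.out.one_lt]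

/-- **`#E(ℚ_p)_tors ∣ c_p · #Ẽ_ns(𝔽_p)` for `E/ℚ` and EVERY `p ≥ 3`** (any reduction type;
`#Ẽ_ns(𝔽_p) = reductionPointCount W p`). [cite: SilvermanAEC2009, VII.3 Prop. 3.1 with VII.2.1 and VII.6.1] -/
theorem card_torsion_baseChange_dvd (hp3 : 3 ≤ p) :
    Nat.card (AddCommGroup.torsion (W.baseChange ℚ_[p]).toAffine.Point) ∣
      (W.baseChange ℚ_[p]).localTamagawaNumber ℤ_[p] * reductionPointCount W p := by
  rw [← LocalTorsion.natCard_point_reduction_baseChange_padic W p]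
  exact card_torsion_dvd_of_isMinimal (W.baseChange ℚ_[p]) hp3

end Rat

end Summit.BirchSwinnertonDyer.Rank1Residual.Additive.LocalLog

end
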